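/- Copyright: the b2b-balaban cell (near-miss cell 7), T⁴-continuum fan-out; row NE7b ROUND-2 swarm, seat
t4-ne7b-formalise-leaf-02 (gen 9) (row S12 «ASSEMBLY», owner sub-row S12i «APEX∕HEADLINE OVER END v3» — its v1.1 OVER THE
REPAIRED END v3.1 of row S12j «THRESHOLD-PAID MULTIPLICITY»; rulings R-OWNER-23-9∕-10∕-11, journal l.15621∕15837∕16149).
Released under the licence of the surrounding project. -/
import Summits.QuantumFields.BalabanUV.T4Continuum.Support.HistoryRealiseCellsRunPinnedT3bP
import Summits.QuantumFields.BalabanUV.T4Continuum.Support.HistoryRealiseCellsRunApexT3b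
import Summits.QuantumFields.BalabanUV.T4Continuum.Support.HistoryConstantsSlackT3bP

/-!
# Realised histories: THE APEX INPUT AND THE HEADLINE FROM THE COUNT ROAD OVER THE REPAIRED END v3.1 — NO DEMAND ON PRINT'S CONSTANTS

Summits-side support leaf of the T⁴-continuum cell (rung (B)+1 on a FINITE torus only; NOT infinite volume, NOT the
mass gap, NOT the Clay statement; NOT a proof of the spine estimate NE7b).  Row S12 ∕ node A12-I of the claim table
`t4/b2b-balaban-t4-ne7b-p1/LEAVES-NE7b.md`, owner sub-row S12i — the «v1.1 over v3.1» booked by R-OWNER-23-10 (2)(d) ∕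
R-OWNER-23-11 (iv), filed as a NEW module (file 3 `HistoryRealiseCellsRunHeadlineT3b` p223402 is at 337 lines).  Twin of
file 3 with the pinned END swapped: `HistoryRealiseCellsRunPinnedT3b.hybridNE7_of_realisedDomainsRun_pinnedT3bD` (over END
v3′, p222798) ↦ `HistoryRealiseCellsRunPinnedT3bP.hybridNE7_of_realisedDomainsRun_pinnedT3bPD` (over END v3.1 =
`HistoryRealiseCellsRunMultEndPD.hybridNE7_of_realisedDomainsRun_printedT3bPD`, leaf-03 gen 3, with the level `P` and
`hθJ : Θ ≤ θ·P` DISCHARGED from the coupling threshold by leaf-05 gen 6's `HistoryFlowProfileLevel`).  The witness shape is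
UNCHANGED: `HistoryRealiseCellsRunApexT3b.CountRoadWitnessT3b` (p223239) — the repair touches only the flow ∕ constants side,
which the pinned form discharges before the term data are bound.

WHAT.  **`hybridNE7Under_of_countRoadT3bP_fsc`**: `T4ApexHybrid.HybridNE7Under D (BetaPertHyp D.βfun)` from the datum's sign
conventions, the constants-side side conditions OF THE REPAIRED END — `ThresholdOK`, `0 < μ`, κ₁∕E₀ largeness, `1 ≤ A₀`,
`0 < β₀`, `F.L·β₀ ≤ 1`, `13 ≤ n₁`, `0 < n`, ANY POSITIVE class-linear slack `0 < θ`, `C.a + θ ≤ ½·O.γ₀·O.A₁²`, the signs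
`0 < E₂`, `0 ≤ E₃`, the count's stride ∕ decay arithmetic `hsS hsmall hθc0 hθc1 hθcs` (symbolic, c2; NO `Dominates`,
**NO `hθJ`, NO demand on print's O(1) constants**) — and ONE displayed hypothesis UNDER THE PREFIX
`T4ContinuumYM4Torus.ForSmallCouplings`: «for all SMALL-coupling tuned runs `g₀` and all loop strings `os`, a
`CountRoadWitnessT3b`»; thresholds of the pinned END v3.1 and of the hypothesis merged by `min`.
**`hybridNE7Under_of_countRoadT3bP`** (every `γ, g > 0`; corollary), **`limit_exists_of_countRoadT3bP_fsc`** ∕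
**`limit_unique_of_countRoadT3bP_fsc`**, **`targets_of_countRoadT3bP_fsc`** ((0.4)-block-averaged data on `SU(N)`,
measurable small-loop average) and **`continuumYM4Torus_of_countRoadT3bP_fsc`** — THE HEADLINE PREDICATE
`T4ContinuumYM4Torus.ContinuumYM4Torus D` from the two pins `hB : B16.EndStatementBPrinted D.C`, `hβ : BetaPertHyp D.βfun`,
the displayed witness hypothesis and the side conditions above.  **`exists_consts_countRoadT3bP`**: THE CONSTANTS-SIDE
ANTECEDENT IS INHABITED for every positive printed `O` (`PrintedO1s.Pos`), every family `F` and every `d rr n ≥ 1` — BY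
NAME from leaf-08 gen 7's after-column census `HistoryConstantsSlackT3bP.END3P_consts_window` (contrast: file 3's
`demand_of_countRoadT3b_consts`, the v3′ antecedent was EMPTY for O(1) constants).

HONEST READING (verbatim for headlines; c4).  The cell's honest dependency chain made kernel-explicit THROUGH ROW NE7b's
REPAIRED END v3.1: `ContinuumYM4Torus D ⇐ (B) ∧ BetaPertHyp ∧ [∀ small-coupling tuned run ∀ string: CountRoadWitnessT3b]`
(+ sign conventions + INHABITED constants-side side conditions), and the witness DISPLAYS — as hypothesis shapes, none in
print, none a theorem of the tree — H3 (the terms of Bałaban's expansion read as realised pedigrees with domains, live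
components dated ≤ cutoff, `DisjointJoins` ∕ `BoxedBirths`, realised costs, the price sentences in print's currency with the
displayed discount `exp(−Ξ)`, the numerator readings over the physical member families), the E1∕E2 representation, the (γ)
floors ∕ site budgets ∕ envelopes of the (B) side, NE7c's `ShellWeightBound`, NE7's `ReindexedBudget` (carrying node U4′'s
sizes and the recent-scale rates, hence the content of NE1′–NE5, NE9) and four summable rates.  Against file 3 (v3′ form):
the slot MULTIPLICITY is a theorem (THE LAST JUNCTION) AND its class-linear price is now charged to the coupling threshold
(a larger `g₁` inside `ForSmallCouplings`), so the located demand `8·8710^d < ½γ₀A₁²` of F-leaf08g7-1 is GONE from the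
antecedent; against the owner's v2 form (p219850): no `Dominates`, no displayed `resum` placement sum — `resumM` (the
dead-part resummation over terms with equal physical live data, print's p. 383 resummation proper) remains, inside H3.
Spine count 0∕9 UNCHANGED; NE7b NOT proved.  [folklore] composition by name; no `def`, no `[cite:]` tag, nothing printed
asserted.  HONEST DEPENDENCY (cell): continuum YM on T⁴ ⇐ BetaPertH ∧ nine spine estimates (0/9 proved); BetaPertH ⇐ (D1)
∧ (D4) ∧ CAP+tail; G-an2-4 gates asym, D1 and NE2/3/4.  This file changes none of it. -/

open Literature.MathematicalPhysics.QuantumFieldTheory.Balaban1983to89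
open T4Continuum T4PrintedShapeBanking T4CanonicalMenus
open Summit.QuantumFields.BalabanUV.T4Continuum.CountThresholdUniform
open Summit.QuantumFields.BalabanUV.T4Continuum.HistoryConstants
open Summit.QuantumFields.BalabanUV.T4Continuum.HistoryZoneEvolve (cth)
open Summit.QuantumFields.BalabanUV.T4Continuum.HistoryRealiseCellsRunPinnedT3bP
open Summit.QuantumFields.BalabanUV.T4Continuum.HistoryRealiseCellsRunApexT3b

namespace Summit.QuantumFields.BalabanUV.T4Continuum.HistoryRealiseCellsRunHeadlineT3bP

noncomputable section

section Under

variable {F : T4Family} {G : Type*} [GaugeGroup G] [MeasurableSpace G] [HaarData G] [RegularGaugeGroup G]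

/-- **ROW NE7b AT THE APEX OVER THE REPAIRED END v3.1: `HybridNE7Under D (BetaPertHyp D.βfun)` FROM THE PREFIXED WITNESS
HYPOTHESIS, NO DEMAND ON PRINT's CONSTANTS.**  For data with measurable averaging maps, the datum's sign conventions and the
repaired END's constants-only side conditions (any positive slack `θ`; inhabited — `exists_consts_countRoadT3bP`): if
`ForSmallCouplings D (g₀ ↦ ∀ os, a CountRoadWitnessT3b)` (H3 + representation + (B)-side data + NE7c + NE7 + rates —
DISPLAYED, none in print, none a theorem of the tree), then the apex input holds; thresholds `min γ₁ γ₂`, `min g₁ g₂` of the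
pinned END v3.1 (`hybridNE7_of_realisedDomainsRun_pinnedT3bPD` — consuming `(B)`, `BetaPertHyp` BY NAME and paying the
multiplicity's level inside its `g₁`) and of the hypothesis.  Honest reading: the four T⁴ targets ⇐ (B) ∧ BetaPertHyp ∧
[∀ small-coupling tuned run ∀ string, a count-road witness].  NE7b NOT proved. [folklore] -/
theorem hybridNE7Under_of_countRoadT3bP_fsc (D : FiniteEpsData F G) (hM : D.AvgMeasurable)
    (hsign : B16.SignConventions D.C)
    {C : T4PrintedShapeBanking.Consts} {O : PrintedO1s}
    {rr : ℕ} {β₀ : ℝ} (h : ThresholdOK C F.L rr β₀) (hμ : 0 < C.μ) (d n : ℕ)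
    (hκ₁ : (d : ℝ) * Real.log F.L + 2 * Real.log 2 ≤ C.κ₁) (hE₀ : Real.log (2 + birthMass C) ≤ C.E₀)
    (hA₀ : 1 ≤ C.A₀) (hβ₀ : 0 < β₀) (hLβ : (F.L : ℝ) * β₀ ≤ 1) (hn₁ : 13 ≤ C.n₁) (hn : 0 < n)
    {θ : ℝ} (hθ : 0 < θ) (hslack : C.a + θ ≤ O.γ₀ * O.A₁ ^ 2 / 2)
    (hE₂ : 0 < C.E₂) (hE₃ : 0 ≤ C.E₃) {sS : ℕ} (hsS : 1 ≤ sS)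
    (hsmall : (((2 * cth 32 1 sS + 1) ^ d : ℕ) : ℝ) * (5 : ℝ) ^ d * ((max 1 (2 * 32 + 2) : ℕ) : ℝ) ≤
      (F.L : ℝ) ^ (sS / 2) / 2)
    {θc : ℝ} (hθc0 : 0 ≤ θc) (hθc1 : θc < 1) (hθcs : 1 / 2 ≤ θc ^ sS)
    (hData : T4ContinuumYM4Torus.ForSmallCouplings D fun g₀ => ∀ os : List (ULoop F),
        ∃ (ι α π : Type) (_ : DecidableEq ι) (_ : DecidableEq α) (_ : DecidableEq π),
          Nonempty (CountRoadWitnessT3b D C O rr d n hn g₀ os ι α π)) :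
    T4ApexHybrid.HybridNE7Under D (BetaPertHyp D.βfun) := by
  intro hB hβ
  obtain ⟨γ₁, hγ₁, H⟩ := hybridNE7_of_realisedDomainsRun_pinnedT3bPD D hB hβ hsign h hμ d n hκ₁ hE₀ hA₀ hβ₀ hLβ hn₁ hn
    hθ hslack hE₂ hE₃ hsS hsmall hθc0 hθc1 hθcs
  obtain ⟨γ₂, hγ₂, H₂⟩ := hData
  refine ⟨min γ₁ γ₂, lt_min hγ₁ hγ₂, fun γ hγ hγle => ?_⟩
  obtain ⟨g₁, hg₁, Hg⟩ := H γ hγ (hγle.trans (min_le_left _ _))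
  obtain ⟨g₂, hg₂, Hg₂⟩ := H₂ γ hγ (hγle.trans (min_le_right _ _))
  refine ⟨min g₁ g₂, lt_min hg₁ hg₂, fun g hg hgle g₀ ht os => ?_⟩
  obtain ⟨Em, -, HE⟩ := Hg g hg (hgle.trans (min_le_left _ _))
  obtain ⟨ι, α, π, _, _, _, ⟨X⟩⟩ := Hg₂ g hg (hgle.trans (min_le_right _ _)) g₀ ht os
  have hm : ∀ K o, Measurable ((D.scheme g₀).obs K o) := fun K o => D.measurable_avgObs hM K o
  have h1 : ∀ K o U, |(D.scheme g₀).obs K o U| ≤ 1 := fun K o U => D.abs_avgObs_le_one K o U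
  obtain ⟨K₁, K₂, hK₁, hH⟩ := HE g₀ ht X.l₀ X.vol X.K₀ X.T X.A X.A' X.shA X.shB X.dead X.dead' X.nup X.mup X.Nup
    X.Cc X.Rr X.CcRec X.RrRec X.ν X.u X.s₂ X.q₀ X.r X.s X.Wsh (fun K => T4GenFunBounds.prodObs (D.scheme g₀) K os) 1
    (fun K => T4GenFunBounds.measurable_prodObs (D.scheme g₀) hm K os)
    (fun K U => T4GenFunBounds.abs_prodObs_le_one (D.scheme g₀) h1 K os U)
    (fun K t ht hK => (X.reprA K t ht hK).le) (fun K t ht hK => (X.reprB K t ht hK).le) X.c₀ X.n₁ X.c₀_pos X.floor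
    X.floor' X.sites X.sites' X.Nup_nonneg X.nup_bd X.mup_bd X.R X.isRj X.one_le_R X.ped X.cellP X.liveC X.Zd X.realised
    X.step_le X.disjointJoins X.boxedBirths X.κ X.κ' X.cost_le X.cost_le' X.FcM X.RfM X.FcM' X.RfM' X.priceM X.priceM'
    X.upM X.deadM_nonneg X.resumM X.FM_nonneg X.upM' X.deadM'_nonneg X.resumM' X.FM'_nonneg X.shell X.budget X.sum_r
    X.sum_u X.sum_s X.sum_s₂
  exact ⟨X.l₀, X.vol, K₁ + K₂, X.l₀_pos, X.vol_pos, stringHybridNE7_of_hybridNE7T3b D X hK₁ hH⟩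

/-- **The every-`γ, g > 0` form** (a witness for EVERY positive-coupling tuned run and every string; thresholds `1, 1` on
the hypothesis' side): corollary of `hybridNE7Under_of_countRoadT3bP_fsc`.  CONDITIONAL; NE7b NOT proved. [folklore] -/
theorem hybridNE7Under_of_countRoadT3bP (D : FiniteEpsData F G) (hM : D.AvgMeasurable)
    (hsign : B16.SignConventions D.C)
    {C : T4PrintedShapeBanking.Consts} {O : PrintedO1s}
    {rr : ℕ} {β₀ : ℝ} (h : ThresholdOK C F.L rr β₀) (hμ : 0 < C.μ) (d n : ℕ)
    (hκ₁ : (d : ℝ) * Real.log F.L + 2 * Real.log 2 ≤ C.κ₁) (hE₀ : Real.log (2 + birthMass C) ≤ C.E₀)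
    (hA₀ : 1 ≤ C.A₀) (hβ₀ : 0 < β₀) (hLβ : (F.L : ℝ) * β₀ ≤ 1) (hn₁ : 13 ≤ C.n₁) (hn : 0 < n)
    {θ : ℝ} (hθ : 0 < θ) (hslack : C.a + θ ≤ O.γ₀ * O.A₁ ^ 2 / 2)
    (hE₂ : 0 < C.E₂) (hE₃ : 0 ≤ C.E₃) {sS : ℕ} (hsS : 1 ≤ sS)
    (hsmall : (((2 * cth 32 1 sS + 1) ^ d : ℕ) : ℝ) * (5 : ℝ) ^ d * ((max 1 (2 * 32 + 2) : ℕ) : ℝ) ≤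
      (F.L : ℝ) ^ (sS / 2) / 2)
    {θc : ℝ} (hθc0 : 0 ≤ θc) (hθc1 : θc < 1) (hθcs : 1 / 2 ≤ θc ^ sS)
    (hData : ∀ (γ g : ℝ) (g₀ : ℕ → ℝ), 0 < γ → 0 < g → D.Tuned γ g g₀ →
      ∀ os : List (ULoop F), ∃ (ι α π : Type) (_ : DecidableEq ι) (_ : DecidableEq α) (_ : DecidableEq π),
        Nonempty (CountRoadWitnessT3b D C O rr d n hn g₀ os ι α π)) :
    T4ApexHybrid.HybridNE7Under D (BetaPertHyp D.βfun) :=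
  hybridNE7Under_of_countRoadT3bP_fsc D hM hsign h hμ d n hκ₁ hE₀ hA₀ hβ₀ hLβ hn₁ hn hθ hslack hE₂ hE₃ hsS hsmall hθc0 hθc1 hθcs
    ⟨1, one_pos, fun γ hγ _ => ⟨1, one_pos, fun g hg _ g₀ ht => hData γ g g₀ hγ hg ht⟩⟩

/-- **COROLLARY: EXISTENCE** of the continuum limit of every joint expectation of unit-scale averaged loop variables along
the full sequence of spacings, under the prefix (`D.ym4_torus_continuum_limit_exists`), GIVEN the prefixed witnesses — by
`T4ApexHybrid.limit_exists_of_hybridNE7Under` over the repaired END v3.1.  CONDITIONAL; NE7b NOT proved. [folklore] -/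
theorem limit_exists_of_countRoadT3bP_fsc (D : FiniteEpsData F G) (hM : D.AvgMeasurable)
    (hsign : B16.SignConventions D.C)
    {C : T4PrintedShapeBanking.Consts} {O : PrintedO1s}
    {rr : ℕ} {β₀ : ℝ} (h : ThresholdOK C F.L rr β₀) (hμ : 0 < C.μ) (d n : ℕ)
    (hκ₁ : (d : ℝ) * Real.log F.L + 2 * Real.log 2 ≤ C.κ₁) (hE₀ : Real.log (2 + birthMass C) ≤ C.E₀)
    (hA₀ : 1 ≤ C.A₀) (hβ₀ : 0 < β₀) (hLβ : (F.L : ℝ) * β₀ ≤ 1) (hn₁ : 13 ≤ C.n₁) (hn : 0 < n)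
    {θ : ℝ} (hθ : 0 < θ) (hslack : C.a + θ ≤ O.γ₀ * O.A₁ ^ 2 / 2)
    (hE₂ : 0 < C.E₂) (hE₃ : 0 ≤ C.E₃) {sS : ℕ} (hsS : 1 ≤ sS)
    (hsmall : (((2 * cth 32 1 sS + 1) ^ d : ℕ) : ℝ) * (5 : ℝ) ^ d * ((max 1 (2 * 32 + 2) : ℕ) : ℝ) ≤
      (F.L : ℝ) ^ (sS / 2) / 2)
    {θc : ℝ} (hθc0 : 0 ≤ θc) (hθc1 : θc < 1) (hθcs : 1 / 2 ≤ θc ^ sS)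
    (hData : T4ContinuumYM4Torus.ForSmallCouplings D fun g₀ => ∀ os : List (ULoop F),
        ∃ (ι α π : Type) (_ : DecidableEq ι) (_ : DecidableEq α) (_ : DecidableEq π),
          Nonempty (CountRoadWitnessT3b D C O rr d n hn g₀ os ι α π)) :
    D.ym4_torus_continuum_limit_exists :=
  T4ApexHybrid.limit_exists_of_hybridNE7Under D hM
    (hybridNE7Under_of_countRoadT3bP_fsc D hM hsign h hμ d n hκ₁ hE₀ hA₀ hβ₀ hLβ hn₁ hn hθ hslack hE₂ hE₃ hsS hsmall hθc0 hθc1 hθcs hData)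

/-- **COROLLARY: UNIQUENESS** of the limit points (`D.ym4_torus_continuum_limit_unique`) under the same displayed data — by
`T4ApexHybrid.limit_unique_of_hybridNE7Under`.  CONDITIONAL; NE7b NOT proved. [folklore] -/
theorem limit_unique_of_countRoadT3bP_fsc (D : FiniteEpsData F G) (hM : D.AvgMeasurable)
    (hsign : B16.SignConventions D.C)
    {C : T4PrintedShapeBanking.Consts} {O : PrintedO1s}
    {rr : ℕ} {β₀ : ℝ} (h : ThresholdOK C F.L rr β₀) (hμ : 0 < C.μ) (d n : ℕ)
    (hκ₁ : (d : ℝ) * Real.log F.L + 2 * Real.log 2 ≤ C.κ₁) (hE₀ : Real.log (2 + birthMass C) ≤ C.E₀)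
    (hA₀ : 1 ≤ C.A₀) (hβ₀ : 0 < β₀) (hLβ : (F.L : ℝ) * β₀ ≤ 1) (hn₁ : 13 ≤ C.n₁) (hn : 0 < n)
    {θ : ℝ} (hθ : 0 < θ) (hslack : C.a + θ ≤ O.γ₀ * O.A₁ ^ 2 / 2)
    (hE₂ : 0 < C.E₂) (hE₃ : 0 ≤ C.E₃) {sS : ℕ} (hsS : 1 ≤ sS)
    (hsmall : (((2 * cth 32 1 sS + 1) ^ d : ℕ) : ℝ) * (5 : ℝ) ^ d * ((max 1 (2 * 32 + 2) : ℕ) : ℝ) ≤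
      (F.L : ℝ) ^ (sS / 2) / 2)
    {θc : ℝ} (hθc0 : 0 ≤ θc) (hθc1 : θc < 1) (hθcs : 1 / 2 ≤ θc ^ sS)
    (hData : T4ContinuumYM4Torus.ForSmallCouplings D fun g₀ => ∀ os : List (ULoop F),
        ∃ (ι α π : Type) (_ : DecidableEq ι) (_ : DecidableEq α) (_ : DecidableEq π),
          Nonempty (CountRoadWitnessT3b D C O rr d n hn g₀ os ι α π)) :
    D.ym4_torus_continuum_limit_unique :=
  T4ApexHybrid.limit_unique_of_hybridNE7Under D hM
    (hybridNE7Under_of_countRoadT3bP_fsc D hM hsign h hμ d n hκ₁ hE₀ hA₀ hβ₀ hLβ hn₁ hn hθ hslack hE₂ hE₃ hsS hsmall hθc0 hθc1 hθcs hData)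

end Under

section SU

variable {F : T4Family} {N : ℕ} [NeZero N] {ℰ : LoopAverage (Matrix.specialUnitaryGroup (Fin N) ℂ)}

/-- **THE FOUR T⁴ TARGETS FROM THE COUNT ROAD OVER THE REPAIRED END v3.1**, for (0.4)-block-averaged data on `SU(N)` with a
measurable small-loop average: `hybridNE7Under_of_countRoadT3bP_fsc` ∘ `T4ApexHybrid.targets_of_hybridNE7Under`.  CONDITIONAL
on (B), `BetaPertHyp` (inside the targets' own prefix) and the displayed prefixed witnesses; NE7b NOT proved. [folklore] -/
theorem targets_of_countRoadT3bP_fsc (D : FiniteEpsData F (Matrix.specialUnitaryGroup (Fin N) ℂ))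
    (hBA : D.IsBlockAveraged ℰ) (hE : ℰ.MeasurableE) (hsign : B16.SignConventions D.C)
    {C : T4PrintedShapeBanking.Consts} {O : PrintedO1s}
    {rr : ℕ} {β₀ : ℝ} (h : ThresholdOK C F.L rr β₀) (hμ : 0 < C.μ) (d n : ℕ)
    (hκ₁ : (d : ℝ) * Real.log F.L + 2 * Real.log 2 ≤ C.κ₁) (hE₀ : Real.log (2 + birthMass C) ≤ C.E₀)
    (hA₀ : 1 ≤ C.A₀) (hβ₀ : 0 < β₀) (hLβ : (F.L : ℝ) * β₀ ≤ 1) (hn₁ : 13 ≤ C.n₁) (hn : 0 < n)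
    {θ : ℝ} (hθ : 0 < θ) (hslack : C.a + θ ≤ O.γ₀ * O.A₁ ^ 2 / 2)
    (hE₂ : 0 < C.E₂) (hE₃ : 0 ≤ C.E₃) {sS : ℕ} (hsS : 1 ≤ sS)
    (hsmall : (((2 * cth 32 1 sS + 1) ^ d : ℕ) : ℝ) * (5 : ℝ) ^ d * ((max 1 (2 * 32 + 2) : ℕ) : ℝ) ≤
      (F.L : ℝ) ^ (sS / 2) / 2)
    {θc : ℝ} (hθc0 : 0 ≤ θc) (hθc1 : θc < 1) (hθcs : 1 / 2 ≤ θc ^ sS)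
    (hData : T4ContinuumYM4Torus.ForSmallCouplings D fun g₀ => ∀ os : List (ULoop F),
        ∃ (ι α π : Type) (_ : DecidableEq ι) (_ : DecidableEq α) (_ : DecidableEq π),
          Nonempty (CountRoadWitnessT3b D C O rr d n hn g₀ os ι α π)) :
    D.ym4_torus_continuum_limit_exists ∧ D.ym4_torus_continuum_limit_unique ∧
      D.limit_reflectionPositive ∧ D.limit_torusCovariant :=
  T4ApexHybrid.targets_of_hybridNE7Under hBA hE
    (hybridNE7Under_of_countRoadT3bP_fsc D (hBA.avgMeasurable hE) hsign h hμ d n hκ₁ hE₀ hA₀ hβ₀ hLβ hn₁ hn hθ hslack hE₂ hE₃ hsS hsmall hθc0 hθc1 hθcs hData)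

/-- **THE HEADLINE PREDICATE FROM THE COUNT ROAD OVER THE REPAIRED END v3.1**: `T4ContinuumYM4Torus.ContinuumYM4Torus D` for
(0.4)-block-averaged data on `SU(N)` with a measurable small-loop average, GIVEN the two pins
`(B) = B16.EndStatementBPrinted D.C` and `BetaPertHyp D.βfun` BY NAME, the datum's sign conventions, the repaired END's
INHABITED constants-only side conditions (any positive slack; `exists_consts_countRoadT3bP`), and a `CountRoadWitnessT3b` for
all small-coupling tuned runs and every loop string (`targets_of_countRoadT3bP_fsc` ∘
`T4ContinuumYM4Torus.continuumYM4Torus_of_targets`).  Honest reading in the module docstring: the located new estimates are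
INSIDE the witness; nothing of them is discharged; the multiplicity is a theorem and its price sits in the coupling
threshold; NE7b NOT proved; count 0∕9. [folklore] -/
theorem continuumYM4Torus_of_countRoadT3bP_fsc (D : FiniteEpsData F (Matrix.specialUnitaryGroup (Fin N) ℂ))
    (hBA : D.IsBlockAveraged ℰ) (hE : ℰ.MeasurableE)
    (hB : B16.EndStatementBPrinted D.C) (hβ : BetaPertHyp D.βfun) (hsign : B16.SignConventions D.C)
    {C : T4PrintedShapeBanking.Consts} {O : PrintedO1s}
    {rr : ℕ} {β₀ : ℝ} (h : ThresholdOK C F.L rr β₀) (hμ : 0 < C.μ) (d n : ℕ)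
    (hκ₁ : (d : ℝ) * Real.log F.L + 2 * Real.log 2 ≤ C.κ₁) (hE₀ : Real.log (2 + birthMass C) ≤ C.E₀)
    (hA₀ : 1 ≤ C.A₀) (hβ₀ : 0 < β₀) (hLβ : (F.L : ℝ) * β₀ ≤ 1) (hn₁ : 13 ≤ C.n₁) (hn : 0 < n)
    {θ : ℝ} (hθ : 0 < θ) (hslack : C.a + θ ≤ O.γ₀ * O.A₁ ^ 2 / 2)
    (hE₂ : 0 < C.E₂) (hE₃ : 0 ≤ C.E₃) {sS : ℕ} (hsS : 1 ≤ sS)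
    (hsmall : (((2 * cth 32 1 sS + 1) ^ d : ℕ) : ℝ) * (5 : ℝ) ^ d * ((max 1 (2 * 32 + 2) : ℕ) : ℝ) ≤
      (F.L : ℝ) ^ (sS / 2) / 2)
    {θc : ℝ} (hθc0 : 0 ≤ θc) (hθc1 : θc < 1) (hθcs : 1 / 2 ≤ θc ^ sS)
    (hData : T4ContinuumYM4Torus.ForSmallCouplings D fun g₀ => ∀ os : List (ULoop F),
        ∃ (ι α π : Type) (_ : DecidableEq ι) (_ : DecidableEq α) (_ : DecidableEq π),
          Nonempty (CountRoadWitnessT3b D C O rr d n hn g₀ os ι α π)) :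
    T4ContinuumYM4Torus.ContinuumYM4Torus D :=
  T4ContinuumYM4Torus.continuumYM4Torus_of_targets hB hβ
    (targets_of_countRoadT3bP_fsc D hBA hE hsign h hμ d n hκ₁ hE₀ hA₀ hβ₀ hLβ hn₁ hn hθ hslack hE₂ hE₃ hsS hsmall hθc0 hθc1 hθcs hData)

end SU

section Consts

/-- **THE CONSTANTS-SIDE ANTECEDENT OF THE REPAIRED HEADLINE IS INHABITED** — for every positive printed `O`, every family
`F`, every `d rr` and `n := 1`: a record `C`, a `β₀`, a positive slack `θ`, a stride `sS` and a decay `θc` meeting EVERY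
constants-side binder of `hybridNE7Under_of_countRoadT3bP_fsc` ∕ `continuumYM4Torus_of_countRoadT3bP_fsc` — BY NAME from
leaf-08 gen 7's after-column census `HistoryConstantsSlackT3bP.END3P_consts_of_pos` at `L := F.L` (its extra conjuncts —
`Dominates`, the level `x` with `1 ≤ C.A₀·x^p₀` and `Θ ≤ θ·(C.A₀·x^p₀)` — are dropped: the pinned END v3.1 finds its own
level).  Contrast file 3's `demand_of_countRoadT3b_consts`: the v3′ antecedent forced `8·8710^d < ½γ₀A₁²`. [folklore] -/
theorem exists_consts_countRoadT3bP {O : PrintedO1s} (hO : O.Pos) (F : T4Family) (d rr : ℕ) :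
    ∃ (C : T4PrintedShapeBanking.Consts) (β₀ θ : ℝ) (sS : ℕ) (θc : ℝ) (n : ℕ),
      ThresholdOK C F.L rr β₀ ∧ 0 < C.μ ∧
      (d : ℝ) * Real.log F.L + 2 * Real.log 2 ≤ C.κ₁ ∧ Real.log (2 + birthMass C) ≤ C.E₀ ∧
      1 ≤ C.A₀ ∧ 0 < β₀ ∧ (F.L : ℝ) * β₀ ≤ 1 ∧ 13 ≤ C.n₁ ∧ 0 < n ∧
      0 < θ ∧ C.a + θ ≤ O.γ₀ * O.A₁ ^ 2 / 2 ∧ 0 < C.E₂ ∧ 0 ≤ C.E₃ ∧ 1 ≤ sS ∧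
      (((2 * cth 32 1 sS + 1) ^ d : ℕ) : ℝ) * (5 : ℝ) ^ d * ((max 1 (2 * 32 + 2) : ℕ) : ℝ) ≤ (F.L : ℝ) ^ (sS / 2) / 2 ∧
      0 ≤ θc ∧ θc < 1 ∧ 1 / 2 ≤ θc ^ sS := by
  obtain ⟨C, β₀, θ, x, sS, θc, h, -, hμ, hκ₁, hE₀, hA₀, hn₁, hE₂, hE₃, hβ₀, hLβ, hθ, hslack, hsS, hsmall, hθc0, hθc1,
    hθcs, -, -, -⟩ := HistoryConstantsSlackT3bP.END3P_consts_of_pos hO d (HistoryFlow.two_le_L F) rr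
  exact ⟨C, β₀, θ, sS, θc, 1, h, hμ, hκ₁, hE₀, hA₀, hβ₀, hLβ, hn₁, one_pos, hθ, hslack, hE₂, hE₃, hsS, hsmall, hθc0, hθc1,
    hθcs⟩

end Consts

end

end Summit.QuantumFields.BalabanUV.T4Continuum.HistoryRealiseCellsRunHeadlineT3bP
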